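import Summits.HodgeConjecture.HodgeConjecture.Theorems.NikulinTwinTransportHodgeSimilitudeAlgebraicTwinTransport
import Summits.HodgeConjecture.HodgeConjecture.Theorems.NikulinTwinTransportHodgeSimilitudeAlgebraicKunnethComplexBetti
import Summits.HodgeConjecture.HodgeConjecture.Theorems.NikulinTwinTransportSquarePairing
import Literature.AlgebraicGeometry.Surfaces.K3ComplexMultiplication
import Literature.AlgebraicGeometry.Surfaces.K3SurfaceProofs
import Literature.AlgebraicGeometry.HodgeTheory.CupPreservesHodgeTypeOfDeRham
import Literature.AlgebraicGeometry.HodgeTheory.HodgeTypePullback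
import Literature.AlgebraicGeometry.HodgeTheory.HodgeTypeConjugation
import Literature.AlgebraicGeometry.HodgeTheory.VanishingCohomologyNontrivialProofs

/-!
# Route NikulinTwinTransport · crux `HodgeSimilitudeAlgebraic` (stmt-HodgeConjecture-13676) —
# line `cm-norm-anchors`, stub `stub_cmSelfSimilitude_algebraic`: rational Hodge self-similitudes
# of CM K3 surfaces are algebraic correspondences (the anchor theorem)

Stub 4 of the skeleton `Cruxes.HodgeSimilitudeAlgebraic.CmNormAnchors` (lead reshape r2; registered
statement, verbatim). For a rational `c`-similitude `J` (`c ≠ 0`) of `(Λ_ℂ, k3Form)` and a marked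
projective K3 surface `(S, η, p)` whose period `x₀` is an eigen-period of `J` with NON-REAL eigenvalue
`t`, the self-map `e = η⁻¹ ∘ J ∘ η` of `H²(S(ℂ); ℂ)` is `[γ]_* = fst_*(snd^*(·) ∪ γ)` for an algebraic
class `γ ∈ N²H⁴(S × S)` — GRANTED three named facts, hypotheses of the statement: de Rham's theorem
in multiplicative form (`exists_deRhamIsoFamily`, the tree's only source of the bigrading of the cup
product on the fourfold `S ⊗ S`, `cupPreservesHodgeType_of_exists_deRhamIsoFamily`), the Hodge
conjecture for squares of CM K3 surfaces (`Buskin2019_hodgeConjectureFor_square_of_CM`, Buskin's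
Corollary / Huybrechts 2019 Cor. 0.4 (ii)) and the Hodge types of `H²(K3)` (`Huybrechts_K3_hodgeTypes_H2`).

## Proof

1. `e` is rational (`isRationalClass_markingConj`) and type-preserving (`isOfHodgeType_markingConj`,
   `S = S'`, period condition `J x₀ = t x₀`), and `e σ = t σ` on the non-zero `(2,0)`-class
   `σ = η⁻¹ x₀` with `t ∉ ℝ`: this IS `HasComplexMultiplication S`, so `HC(S ⊗ S)` holds and `S ⊗ S`
   has a Hodge model (`nonempty_hodgeModel_tensor_self_of_CM`), through which `fst^*`, `snd^*`
   preserve Hodge types (`preservesHodgeType_of_independent`) and `∪` adds them (de Rham).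
2. THE GRAPH CLASS. With `εⱼ = η⁻¹ eⱼ`, `δⱼ = η⁻¹(G⁻¹ eⱼ)` the dual pair of lattice bases for the cup
   form (`dualPair_marking`, module `…KunnethComplexBetti`) and `Φ(v, u) = fst^*(e v) ∪ snd^* u`, the
   class `γ₀ = Σⱼ Φ(εⱼ, δⱼ) ∈ H⁴((S ⊗ S)(ℂ); ℂ)` acts as `[γ₀]_* y = c₀ • e y` (`corr_cross` and fibre
   integration `fst_*(snd^* p) = c₀ • 1`, `c₀ ≠ 0` — `exists_fibreIntegral`, unconditional by the
   Künneth spanning theorem `kunnethSpan_complexBetti`); `γ₀` is rational termwise; and `γ₀` is of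
   type `(2,2)` by the Casimir decomposition `prop_sum_dualPair_of_projections` along the type
   projections `π₂₀, π₁₁, π₀₂` of `H²(S)` (`exists_typeProjections`):
   `γ₀ = Σ Φ(π₂₀ε, π₀₂δ) + Σ Φ(π₁₁ε, π₁₁δ) + Σ Φ(π₀₂ε, π₂₀δ)`, each term of type `(2,2)`.
3. `γ = c₀⁻¹ γ₀ ∈ algebraicClasses (S ⊗ S) 2` (`mem_algebraicClasses_tensor_self_of_CM`: rational
   `(2,2)`-classes on the CM square are algebraic, a `ℂ`-submodule) and `[γ]_* = e`.

References: [Buskin2019] N. Buskin, Every rational Hodge isometry between two K3 surfaces is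
algebraic, J. reine angew. Math. 755 (2019), Corollary after Thm. 1.1, Lemma 6.3. [Huybrechts2019]
D. Huybrechts, Motives of isogenous K3 surfaces, Comment. Math. Helv. 94 (2019), Cor. 0.4 (ii).
[Huybrechts2016K3] D. Huybrechts, Lectures on K3 Surfaces, CUP 2016, Ch. 6 Prop. 1.2, Ch. 14 §0.3.
[WarnerGTM94] F. Warner, Foundations of Differentiable Manifolds and Lie Groups, Thm. 5.36 / 5.45.
-/

noncomputable section

open CategoryTheory MonoidalCategory CartesianMonoidalCategory
open scoped Manifold
open Literature.AlgebraicGeometry.Motives Literature.AlgebraicGeometry.HodgeTheory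
open Literature.AlgebraicGeometry.Surfaces
open Literature.AlgebraicTopology.SingularHomology
open Summit.HodgeConjecture.HodgeConjecture.Theses.NikulinTwinTransport

namespace Summit.HodgeConjecture.HodgeConjecture.Theorems.NikulinTwinTransport.CmNormAnchors

/-! ### Linear algebra: dual pairs of families, the Casimir transfer, type projections -/
section Casimir

variable {R V W : Type*} [CommRing R] [AddCommGroup V] [Module R V] [AddCommGroup W] [Module R W]
  {ι : Type*} [Fintype ι]

/-- **Casimir transfer.** For families `ε, δ` dual for a bilinear form `B`
(`x = Σⱼ B(x, δⱼ) εⱼ`, `y = Σⱼ B(εⱼ, y) δⱼ`), a bilinear `Φ` and a pair `T, T'` of `B`-adjoint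
endomorphisms (`B(x, T y) = B(T' x, y)`): `Σⱼ Φ(εⱼ, T δⱼ) = Σⱼ Φ(T' εⱼ, δⱼ)` (the element
`Σⱼ εⱼ ⊗ δⱼ` commutes with `End V` acting through `B`). [folklore] -/
theorem sum_dualPair_transfer (B : V →ₗ[R] V →ₗ[R] R) (ε δ : ι → V)
    (hE1 : ∀ x, x = ∑ j, B x (δ j) • ε j) (hE2 : ∀ y, y = ∑ j, B (ε j) y • δ j)
    (Φ : V →ₗ[R] V →ₗ[R] W) (T T' : V →ₗ[R] V) (hT : ∀ x y, B x (T y) = B (T' x) y) :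
    ∑ j, Φ (ε j) (T (δ j)) = ∑ j, Φ (T' (ε j)) (δ j) := by
  have h1 : ∀ j, Φ (ε j) (T (δ j)) = ∑ k, B (T' (ε k)) (δ j) • Φ (ε j) (δ k) := fun j => by
    conv_lhs => rw [hE2 (T (δ j))]
    rw [map_sum]
    refine Finset.sum_congr rfl fun k _ => ?_
    rw [map_smul, hT]
  have h2 : ∀ k, Φ (T' (ε k)) (δ k) = ∑ j, B (T' (ε k)) (δ j) • Φ (ε j) (δ k) := fun k => by
    conv_lhs => rw [hE1 (T' (ε k))]
    rw [map_sum, LinearMap.sum_apply]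
    refine Finset.sum_congr rfl fun j _ => ?_
    rw [map_smul, LinearMap.smul_apply]
  simp_rw [h1, h2]
  exact Finset.sum_comm

/-- **A sum `Σⱼ Φ(εⱼ, δⱼ)` over a dual pair is a sum of "typed" terms.** With three idempotent
endomorphisms `π₁ + π₂ + π₃ = 1` whose `B`-adjoints are `π₃, π₂, π₁` respectively, and a predicate
`P` stable under `0`, `+` holding on `Φ(π₁ v, π₃ u)`, `Φ(π₂ v, π₂ u)`, `Φ(π₃ v, π₁ u)`:
`P (Σⱼ Φ(εⱼ, δⱼ))` — indeed `Σⱼ Φ(εⱼ, δⱼ) = Σⱼ Φ(π₁εⱼ, π₃δⱼ) + Σⱼ Φ(π₂εⱼ, π₂δⱼ) + Σⱼ Φ(π₃εⱼ, π₁δⱼ)`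
(the graph of a type-preserving map lies in `⊕ H^{p,q} ⊗ H^{2-p,2-q}`). [folklore] -/
theorem prop_sum_dualPair_of_projections (B : V →ₗ[R] V →ₗ[R] R) (ε δ : ι → V)
    (hE1 : ∀ x, x = ∑ j, B x (δ j) • ε j) (hE2 : ∀ y, y = ∑ j, B (ε j) y • δ j)
    (Φ : V →ₗ[R] V →ₗ[R] W) (π₁ π₂ π₃ : V →ₗ[R] V) (hsum : ∀ x, π₁ x + π₂ x + π₃ x = x)
    (h11 : ∀ x, π₁ (π₁ x) = π₁ x) (h22 : ∀ x, π₂ (π₂ x) = π₂ x) (h33 : ∀ x, π₃ (π₃ x) = π₃ x)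
    (ha1 : ∀ x y, B x (π₃ y) = B (π₁ x) y) (ha2 : ∀ x y, B x (π₂ y) = B (π₂ x) y)
    (ha3 : ∀ x y, B x (π₁ y) = B (π₃ x) y)
    (P : W → Prop) (hP0 : P 0) (hPadd : ∀ a b, P a → P b → P (a + b))
    (hP13 : ∀ v u, P (Φ (π₁ v) (π₃ u))) (hP22 : ∀ v u, P (Φ (π₂ v) (π₂ u)))
    (hP31 : ∀ v u, P (Φ (π₃ v) (π₁ u))) :
    P (∑ j, Φ (ε j) (δ j)) := by
  have hPsum : ∀ f : ι → W, (∀ j, P (f j)) → P (∑ j, f j) := fun f hf =>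
    Finset.sum_induction f P (fun a b => hPadd a b) hP0 fun j _ => hf j
  -- split the first slot along `π₁ + π₂ + π₃ = 1`
  have hsplit : ∑ j, Φ (ε j) (δ j) =
      ∑ j, Φ (π₁ (ε j)) (δ j) + ∑ j, Φ (π₂ (ε j)) (δ j) + ∑ j, Φ (π₃ (ε j)) (δ j) := by
    rw [← Finset.sum_add_distrib, ← Finset.sum_add_distrib]
    refine Finset.sum_congr rfl fun j _ => ?_
    rw [← LinearMap.add_apply, ← LinearMap.add_apply, ← map_add, ← map_add, hsum]
  -- move each projection to the second slot through its adjoint (Casimir transfer)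
  have hk : ∀ (π π' : V →ₗ[R] V), (∀ x, π (π x) = π x) → (∀ x y, B x (π' y) = B (π x) y) →
      ∑ j, Φ (π (ε j)) (δ j) = ∑ j, Φ (π (ε j)) (π' (δ j)) := by
    intro π π' hidem hadj
    have h := sum_dualPair_transfer B ε δ hE1 hE2 (Φ ∘ₗ π) π' π hadj
    simp only [LinearMap.comp_apply] at h
    rw [h]
    exact Finset.sum_congr rfl fun j _ => by rw [hidem]
  rw [hsplit, hk π₁ π₃ h11 ha1, hk π₂ π₂ h22 ha2, hk π₃ π₁ h33 ha3]
  exact hPadd _ _ (hPadd _ _ (hPsum _ fun j => hP13 _ _) (hPsum _ fun j => hP22 _ _))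
    (hPsum _ fun j => hP31 _ _)

/-- **The type projections of a K3-type structure.** For a symmetric bilinear form `B` and vectors
`σ, σ'` with `B(σ,σ) = B(σ',σ') = 0`, `B(σ,σ') = ν ≠ 0`, the endomorphisms
`π₁ x = ν⁻¹ B(x,σ') σ`, `π₃ x = ν⁻¹ B(x,σ) σ'`, `π₂ = 1 - π₁ - π₃` are idempotents summing to `1`,
with `B`-adjoints `π₃, π₂, π₁`, and `π₂` maps into `⟨σ, σ'⟩^⊥` (for `H²` of a K3 surface with
`σ` the `(2,0)`-class: the projections onto `H^{2,0}`, `H^{1,1}`, `H^{0,2}`).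
[cite: Huybrechts2016K3, Ch. 6 Prop. 1.2] -/
theorem exists_typeProjections {K : Type*} [Field K] [Module K V] (B : V →ₗ[K] V →ₗ[K] K)
    (hB : ∀ x y, B x y = B y x) (σ σ' : V) {ν : K} (hν : ν ≠ 0) (hσσ : B σ σ = 0)
    (hσ'σ' : B σ' σ' = 0) (hσσ' : B σ σ' = ν) :
    ∃ π₁ π₂ π₃ : V →ₗ[K] V,
      (∀ x, π₁ x = (ν⁻¹ * B x σ') • σ) ∧ (∀ x, π₃ x = (ν⁻¹ * B x σ) • σ') ∧
      (∀ x, π₁ x + π₂ x + π₃ x = x) ∧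
      (∀ x, π₁ (π₁ x) = π₁ x) ∧ (∀ x, π₂ (π₂ x) = π₂ x) ∧ (∀ x, π₃ (π₃ x) = π₃ x) ∧
      (∀ x y, B x (π₃ y) = B (π₁ x) y) ∧ (∀ x y, B x (π₂ y) = B (π₂ x) y) ∧
      (∀ x y, B x (π₁ y) = B (π₃ x) y) ∧
      (∀ x, B (π₂ x) σ = 0) ∧ (∀ x, B (π₂ x) σ' = 0) := by
  have hσ'σ : B σ' σ = ν := by rw [hB, hσσ']
  let π₁ : V →ₗ[K] V := LinearMap.smulRight (ν⁻¹ • B.flip σ') σ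
  let π₃ : V →ₗ[K] V := LinearMap.smulRight (ν⁻¹ • B.flip σ) σ'
  have h1 : ∀ x, π₁ x = (ν⁻¹ * B x σ') • σ := fun x => by
    simp only [π₁, LinearMap.smulRight_apply, LinearMap.smul_apply, LinearMap.flip_apply, smul_eq_mul]
  have h3 : ∀ x, π₃ x = (ν⁻¹ * B x σ) • σ' := fun x => by
    simp only [π₃, LinearMap.smulRight_apply, LinearMap.smul_apply, LinearMap.flip_apply, smul_eq_mul]
  -- the basic evaluations
  have h1σ : π₁ σ = σ := by rw [h1, hσσ', inv_mul_cancel₀ hν, one_smul]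
  have h1σ' : π₁ σ' = 0 := by rw [h1, hσ'σ', mul_zero, zero_smul]
  have h3σ' : π₃ σ' = σ' := by rw [h3, hσ'σ, inv_mul_cancel₀ hν, one_smul]
  have h3σ : π₃ σ = 0 := by rw [h3, hσσ, mul_zero, zero_smul]
  have h11 : ∀ x, π₁ (π₁ x) = π₁ x := fun x => by
    conv_lhs => rw [h1 x]
    rw [map_smul, h1σ, ← h1 x]
  have h33 : ∀ x, π₃ (π₃ x) = π₃ x := fun x => by
    conv_lhs => rw [h3 x]
    rw [map_smul, h3σ', ← h3 x]
  have h13 : ∀ x, π₁ (π₃ x) = 0 := fun x => by rw [h3, map_smul, h1σ', smul_zero]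
  have h31 : ∀ x, π₃ (π₁ x) = 0 := fun x => by rw [h1, map_smul, h3σ, smul_zero]
  have ha1 : ∀ x y, B x (π₃ y) = B (π₁ x) y := fun x y => by
    rw [h3, h1, map_smul, LinearMap.map_smul₂, smul_eq_mul, smul_eq_mul, hB x σ', hB σ y]
    ring
  have ha3 : ∀ x y, B x (π₁ y) = B (π₃ x) y := fun x y => by
    rw [h1, h3, map_smul, LinearMap.map_smul₂, smul_eq_mul, smul_eq_mul, hB x σ, hB σ' y]
    ring
  refine ⟨π₁, LinearMap.id - π₁ - π₃, π₃, h1, h3, fun x => ?_, h11, fun x => ?_, h33, ha1,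
    fun x y => ?_, ha3, fun x => ?_, fun x => ?_⟩
  · simp only [LinearMap.sub_apply, LinearMap.id_apply]; abel
  · simp only [LinearMap.sub_apply, LinearMap.id_apply, map_sub, h11, h33, h13, h31]
    abel
  · simp only [LinearMap.sub_apply, LinearMap.id_apply, map_sub, LinearMap.sub_apply, ha1, ha3]
    abel
  · rw [LinearMap.sub_apply, LinearMap.sub_apply, LinearMap.id_apply, map_sub, map_sub,
      LinearMap.sub_apply, LinearMap.sub_apply, h1, h3, LinearMap.map_smul₂, LinearMap.map_smul₂,
      smul_eq_mul, smul_eq_mul, hσσ, hσ'σ]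
    field_simp
    ring
  · rw [LinearMap.sub_apply, LinearMap.sub_apply, LinearMap.id_apply, map_sub, map_sub,
      LinearMap.sub_apply, LinearMap.sub_apply, h1, h3, LinearMap.map_smul₂, LinearMap.map_smul₂,
      smul_eq_mul, smul_eq_mul, hσσ', hσ'σ']
    field_simp
    ring

end Casimir

/-! ### The anchor theorem -/
section Stub

/-- `MarkedK3[S, η, p, x]`: a marked K3 surface with period `x`. Local notation only, verbatim
from `NikulinTwinTransportHodgeSimilitudeAlgebraicTwinTransport`. -/
local notation3 (prettyPrint := false) "MarkedK3[" S ", " η ", " p ", " x "]" =>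
  (IsIntegralClass p ∧
    (∀ q : complexBetti S (2 * 2), IsIntegralClass q → ∃ n : ℤ, q = n • p) ∧
    (∀ c : complexBetti S (2 * 1), IsIntegralClass c ↔ ∃ v : K3Index → ℤ, η c = fun i => (v i : ℂ)) ∧
    (∀ a b : complexBetti S (2 * 1),
        cupProduct (rfl : 2 * 1 + 2 * 1 = 2 * 2) a b = k3Form (η a) (η b) • p) ∧
    IsOfHodgeType 2 S (2 * 1) 2 0 (LinearEquiv.symm η x) ∧
    (∀ τ : complexBetti S (2 * 1), IsOfHodgeType 2 S (2 * 1) 2 0 τ → ∃ t : ℂ, τ = t • LinearEquiv.symm η x))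

/-- `PeriodPt[x]`: a projective period point. Local notation only, verbatim from the glue files. -/
local notation3 (prettyPrint := false) "PeriodPt[" x "]" =>
  (k3Form x x = 0 ∧ 0 < (k3Form (star x) x).re ∧
    ∃ u : K3Index → ℤ, k3Form (fun i => (u i : ℂ)) x = 0 ∧ 0 < ∑ i, ∑ j, u i * k3Gram i j * u j)

/-- `Corr[μ, S, S', hS, hS' ; γ, y] = [γ]_* y = fst_* (snd^* y ∪ γ)`. Local notation only,
verbatim from the glue files. -/
local notation3 (prettyPrint := false) "Corr[" μ ", " S ", " S' ", " hS ", " hS' " ; " γ ", " y "]" =>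
  complexGysin μ
    (IsSmoothProjective.tensor_holds (IsK3Surface.isSmoothProjective hS)
      (IsK3Surface.isSmoothProjective hS'))
    (IsK3Surface.isSmoothProjective hS) (SemiCartesianMonoidalCategory.fst S S')
    (rfl : 2 * 1 + 2 * 2 + 2 * 2 = 2 * 1 + 2 * (2 + 2))
    (cupProduct (rfl : 2 * 1 + 2 * 2 = 2 * 1 + 2 * 2)
      (complexBetti.map (SemiCartesianMonoidalCategory.snd S S') (2 * 1) y) γ)

/-- `RatEnd[J]`: the endomorphism `J` of `Λ_ℂ = ℂ²²` is defined over `ℚ` (maps `Λ` into `Λ_ℚ`),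
the idiom of the glue files. Local notation only. -/
local notation3 (prettyPrint := false) "RatEnd[" J "]" =>
  ∀ v : K3Index → ℤ, ∃ w : K3Index → ℚ, J (fun i => (v i : ℂ)) = fun i => (w i : ℂ)

/-- **The anchor theorem, granted the bigrading of the cup product on the fourfold `S ⊗ S`** (and
the CM-square corollary and the Hodge types of `H²(K3)`): for a rational `c`-similitude `J` (`c ≠ 0`)
and a marked projective K3 surface `(S, η, p)` whose period `x₀` is an eigen-period of `J` with
non-real eigenvalue, `η⁻¹ ∘ J ∘ η = [γ]_*` for an algebraic `γ ∈ N²H⁴(S × S)` (the rescaled Künneth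
graph class, rational and of type `(2,2)` on the CM square; see the module docstring).
[cite: Huybrechts2019, Cor. 0.4 (ii)] [cite: Buskin2019, Corollary (Introduction)] -/
theorem cmSelfSimilitude_algebraic_of_cupPreservesHodgeType
    (hcup4 : ∀ S : SchemeOver ℂ, IsK3Surface S →
      Nonempty (HodgeModel 4 (MonoidalCategoryStruct.tensorObj S S)) →
      CupPreservesHodgeType 4 (MonoidalCategoryStruct.tensorObj S S)) :
    Buskin2019_hodgeConjectureFor_square_of_CM → Huybrechts_K3_hodgeTypes_H2 →
    ∀ (c : ℂ), c ≠ 0 → ∀ (J : Module.End ℂ (K3Index → ℂ)), RatEnd[J] →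
      (∀ a b, k3Form (J a) (J b) = c * k3Form a b) →
      ∀ (x₀ : K3Index → ℂ) (t : ℂ), t.im ≠ 0 → J x₀ = t • x₀ →
      ∀ (μ : OrientationFamily), μ.HasPoincareDuality →
        ∀ (S : SchemeOver ℂ) (hS : IsK3Surface S)
          (η : complexBetti S (2 * 1) ≃ₗ[ℂ] (K3Index → ℂ)) (p : complexBetti S (2 * 2)),
          MarkedK3[S, η, p, x₀] → PeriodPt[x₀] →
          ∃ γ ∈ algebraicClasses (MonoidalCategoryStruct.tensorObj S S) 2,
            ∀ y : complexBetti S (2 * 1), η.symm (J (η y)) = Corr[μ, S, S, hS, hS ; γ, y] := by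
  intro hB hHT c hc J hJrat hJc x₀ t htim hJx μ _hμ S hS η p hm hx
  obtain ⟨-, hgen, hint, hcupf, h20, -⟩ := hm
  obtain ⟨hxx, hxpos, -⟩ := hx
  have hSP : IsSmoothProjective 2 S := hS.isSmoothProjective
  have hT4 : IsSmoothProjective 4 (S ⊗ S) := hS.isSmoothProjective_tensor_self
  have hp0 : p ≠ 0 := generator_ne_zero hS hgen
  have hσ0 : η.symm x₀ ≠ 0 := fun h0 =>
    ne_zero_of_star_self_re_pos hxpos (by simpa using congrArg η h0)
  -- the endomorphism `e = η⁻¹ J η`: rational, type-preserving, `e σ = t σ`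
  obtain ⟨e, he⟩ : ∃ e : complexBetti S (2 * 1) →ₗ[ℂ] complexBetti S (2 * 1),
      ∀ y, e y = η.symm (J (η y)) :=
    ⟨η.symm.toLinearMap ∘ₗ J ∘ₗ η.toLinearMap, fun y => rfl⟩
  have he_rat : ∀ y, IsRationalClass y → IsRationalClass (e y) := fun y hy => by
    rw [he]; exact isRationalClass_markingConj η η J hS hS hint hint hJrat hy
  have he_typ : ∀ (i j : ℕ) y, IsOfHodgeType 2 S (2 * 1) i j y →
      IsOfHodgeType 2 S (2 * 1) i j (e y) := fun i j y hy => by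
    rw [he]
    exact isOfHodgeType_markingConj η p x₀ η p x₀ J hHT hS hS hint hcupf h20 hxpos hint hcupf hp0 h20
      hxpos hJrat hc hJc ⟨t, hJx⟩ i j y hy
  have heσ : e (η.symm x₀) = t • η.symm x₀ := by
    rw [he, LinearEquiv.apply_symm_apply, hJx, map_smul]
  -- `S` has complex multiplication, so `HC(S ⊗ S)` holds and `S ⊗ S` has a Hodge model
  have hCM : HasComplexMultiplication S :=
    ⟨e, he_rat, fun i j y hy => he_typ i j y hy, η.symm x₀, t, h20, hσ0, htim, heσ⟩
  obtain ⟨B4⟩ := nonempty_hodgeModel_tensor_self_of_CM hB hS hCM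
  have hfstT : PreservesHodgeType 4 2 (fst S S) :=
    preservesHodgeType_of_independent hodgePQ_independent_of_hodgeModel_holds hT4 hSP B4 (fst S S)
  have hsndT : PreservesHodgeType 4 2 (snd S S) :=
    preservesHodgeType_of_independent hodgePQ_independent_of_hodgeModel_holds hT4 hSP B4 (snd S S)
  have hcupT := hcup4 S hS ⟨B4⟩
  -- fibre integration, the cup form, the dual lattice bases
  obtain ⟨c₀, hc₀, hFI⟩ := exists_fibreIntegral μ hSP hSP hp0
  obtain ⟨Bf, hBf⟩ : ∃ Bf : LinearMap.BilinForm ℂ (complexBetti S (2 * 1)),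
      ∀ x y, Bf x y = k3Form (η x) (η y) :=
    ⟨k3FormC.compl₁₂ η.toLinearMap η.toLinearMap, fun x y => by
      simp only [LinearMap.compl₁₂_apply, LinearEquiv.coe_coe, k3FormC_apply]⟩
  obtain ⟨ε, hε⟩ : ∃ ε : K3Index → complexBetti S (2 * 1),
      ∀ j, ε j = η.symm (fun i => ((Pi.single j (1 : ℤ) : K3Index → ℤ) i : ℂ)) := ⟨_, fun j => rfl⟩
  obtain ⟨δ, hδ⟩ : ∃ δ : K3Index → complexBetti S (2 * 1),
      ∀ j, δ j = η.symm (fun i => ((k3Gram⁻¹ i j : ℤ) : ℂ)) := ⟨_, fun j => rfl⟩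
  obtain ⟨hE1, hE2⟩ := dualPair_marking η Bf hBf ε δ hε hδ
  -- the graph class `γ₀ = Σⱼ Φ εⱼ δⱼ`, `Φ v u = fst^*(e v) ∪ snd^* u`
  obtain ⟨Φ, hΦ⟩ : ∃ Φ : complexBetti S (2 * 1) →ₗ[ℂ] complexBetti S (2 * 1) →ₗ[ℂ]
      complexBetti (S ⊗ S) (2 * 2), ∀ v u, Φ v u = cupProduct (rfl : 2 * 1 + 2 * 1 = 2 * 2)
        (complexBetti.map (fst S S) (2 * 1) (e v)) (complexBetti.map (snd S S) (2 * 1) u) :=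
    ⟨(cupProduct (rfl : 2 * 1 + 2 * 1 = 2 * 2)).compl₁₂
      ((complexBetti.map (fst S S) (2 * 1)).hom ∘ₗ e) (complexBetti.map (snd S S) (2 * 1)).hom,
      fun v u => rfl⟩
  -- (a) the action: `[γ₀]_* y = c₀ • e y`
  have hact : ∀ y : complexBetti S (2 * 1),
      complexGysin μ (IsSmoothProjective.tensor_holds hSP hSP) hSP (fst S S)
        (rfl : 2 * 1 + 2 * 2 + 2 * 2 = 2 * 1 + 2 * (2 + 2))
        (cupProduct (rfl : 2 * 1 + 2 * 2 = 2 * 1 + 2 * 2)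
          (complexBetti.map (snd S S) (2 * 1) y) (∑ j, Φ (ε j) (δ j))) = c₀ • e y := by
    intro y
    rw [map_sum, map_sum]
    simp_rw [hΦ, corr_cross hSP hcupf μ hFI, mul_smul, ← Finset.smul_sum]
    conv_rhs => rw [hE1 y]
    simp only [map_sum, map_smul, hBf]
  -- (b) rationality of `γ₀`
  have hεrat : ∀ j, IsRationalClass (ε j) := fun j =>
    ((hint _).2 ⟨Pi.single j 1, by rw [hε, η.apply_symm_apply]⟩).isRationalClass
  have hδrat : ∀ j, IsRationalClass (δ j) := fun j =>
    ((hint _).2 ⟨fun i => k3Gram⁻¹ i j, by rw [hδ, η.apply_symm_apply]⟩).isRationalClass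
  have hrat : IsRationalClass (∑ j, Φ (ε j) (δ j)) := by
    refine Finset.sum_induction _ IsRationalClass (fun a b => IsRationalClass.add)
      IsRationalClass.zero fun j _ => ?_
    rw [hΦ]
    exact ((he_rat _ (hεrat j)).map _).cup _ ((hδrat j).map _)
  -- (c) `γ₀` is of type `(2,2)`: the type projections of `H²(S)` and the Casimir decomposition
  have hσ' : conjClass (ComplexPoints S) (2 * 1) (η.symm x₀) = η.symm (star x₀) :=
    conjClass_marking_symm η hint x₀
  have hν : k3Form x₀ (star x₀) ≠ 0 := by
    rw [k3Form_comm]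
    intro h0
    rw [h0, Complex.zero_re] at hxpos
    exact lt_irrefl _ hxpos
  have hBsymm : ∀ x y, Bf x y = Bf y x := fun x y => by rw [hBf, hBf, k3Form_comm]
  have hBσσ : Bf (η.symm x₀) (η.symm x₀) = 0 := by rw [hBf, LinearEquiv.apply_symm_apply, hxx]
  have hBσ'σ' : Bf (η.symm (star x₀)) (η.symm (star x₀)) = 0 := by
    rw [hBf, LinearEquiv.apply_symm_apply, ← star_k3Form, hxx, star_zero]
  have hBσσ' : Bf (η.symm x₀) (η.symm (star x₀)) = k3Form x₀ (star x₀) := by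
    rw [hBf, LinearEquiv.apply_symm_apply, LinearEquiv.apply_symm_apply]
  obtain ⟨π₁, π₂, π₃, hπ₁, hπ₃, hsum, h11, h22, h33, ha1, ha2, ha3, hπ₂σ, hπ₂σ'⟩ :=
    exists_typeProjections Bf hBsymm (η.symm x₀) (η.symm (star x₀)) hν hBσσ hBσ'σ' hBσσ'
  have h02 : IsOfHodgeType 2 S (2 * 1) 0 2 (η.symm (star x₀)) :=
    hσ' ▸ Huybrechts_K3_hodgeTypes_H2.conjClass_isOfHodgeType hHT hS h20 hσ0
  have hπ₁typ : ∀ v, IsOfHodgeType 2 S (2 * 1) 2 0 (π₁ v) := fun v => by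
    rw [hπ₁]; exact h20.smul _
  have hπ₃typ : ∀ v, IsOfHodgeType 2 S (2 * 1) 0 2 (π₃ v) := fun v => by
    rw [hπ₃]; exact h02.smul _
  have hπ₂typ : ∀ v, IsOfHodgeType 2 S (2 * 1) 1 1 (π₂ v) := fun v => by
    refine Huybrechts_K3_hodgeTypes_H2.isOfHodgeType_one_one hHT hS h20 hσ0 ?_ ?_
    · have h := hπ₂σ v
      rw [hBf, LinearEquiv.apply_symm_apply] at h
      rw [hcupf, LinearEquiv.apply_symm_apply, h, zero_smul]
    · have h := hπ₂σ' v
      rw [hBf, LinearEquiv.apply_symm_apply] at h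
      rw [hσ', hcupf, LinearEquiv.apply_symm_apply, h, zero_smul]
  have htyp : IsOfHodgeType 4 (S ⊗ S) (2 * 2) 2 2 (∑ j, Φ (ε j) (δ j)) := by
    refine prop_sum_dualPair_of_projections Bf ε δ hE1 hE2 Φ π₁ π₂ π₃ hsum h11 h22 h33 ha1 ha2 ha3
      (fun w => IsOfHodgeType 4 (S ⊗ S) (2 * 2) 2 2 w) (IsOfHodgeType.zero B4 _ _ _)
      (fun a b (ha : IsOfHodgeType 4 (S ⊗ S) (2 * 2) 2 2 a) (hb : IsOfHodgeType 4 (S ⊗ S) (2 * 2) 2 2 b)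
        => ha.add hT4 hb) (fun v u => ?_) (fun v u => ?_) (fun v u => ?_)
    · have h1 : IsOfHodgeType 4 (S ⊗ S) (2 * 1) 2 0 (complexBetti.map (fst S S) (2 * 1) (e (π₁ v))) :=
        hfstT (he_typ 2 0 _ (hπ₁typ v))
      have h2 : IsOfHodgeType 4 (S ⊗ S) (2 * 1) 0 2 (complexBetti.map (snd S S) (2 * 1) (π₃ u)) :=
        hsndT (hπ₃typ u)
      have H := hcupT (rfl : 2 * 1 + 2 * 1 = 2 * 2) h1 h2
      rw [← hΦ] at H
      exact H
    · have h1 : IsOfHodgeType 4 (S ⊗ S) (2 * 1) 1 1 (complexBetti.map (fst S S) (2 * 1) (e (π₂ v))) :=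
        hfstT (he_typ 1 1 _ (hπ₂typ v))
      have h2 : IsOfHodgeType 4 (S ⊗ S) (2 * 1) 1 1 (complexBetti.map (snd S S) (2 * 1) (π₂ u)) :=
        hsndT (hπ₂typ u)
      have H := hcupT (rfl : 2 * 1 + 2 * 1 = 2 * 2) h1 h2
      rw [← hΦ] at H
      exact H
    · have h1 : IsOfHodgeType 4 (S ⊗ S) (2 * 1) 0 2 (complexBetti.map (fst S S) (2 * 1) (e (π₃ v))) :=
        hfstT (he_typ 0 2 _ (hπ₃typ v))
      have h2 : IsOfHodgeType 4 (S ⊗ S) (2 * 1) 2 0 (complexBetti.map (snd S S) (2 * 1) (π₁ u)) :=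
        hsndT (hπ₁typ u)
      have H := hcupT (rfl : 2 * 1 + 2 * 1 = 2 * 2) h1 h2
      rw [← hΦ] at H
      exact H
  -- (d) `γ = c₀⁻¹ γ₀` is algebraic and acts as `e`
  have halg : (∑ j, Φ (ε j) (δ j)) ∈ algebraicClasses (S ⊗ S) 2 :=
    mem_algebraicClasses_tensor_self_of_CM hB hS hCM 2 _ hrat htyp
  refine ⟨c₀⁻¹ • ∑ j, Φ (ε j) (δ j), Submodule.smul_mem _ _ halg, fun y => ?_⟩
  rw [map_smul, map_smul, hact y, smul_smul, inv_mul_cancel₀ hc₀, one_smul, he]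

/-- **Stub 4 — `stub_cmSelfSimilitude_algebraic`, THE ANCHOR THEOREM (registered statement, verbatim):
rational Hodge self-similitudes of CM K3 surfaces are algebraic correspondences**, granted de Rham's
theorem in multiplicative form (it yields the bigrading of the cup product on `S ⊗ S`,
`cupPreservesHodgeType_of_exists_deRhamIsoFamily`, on the Hodge model supplied by the CM-square
corollary), the Hodge conjecture for squares of CM K3 surfaces, and the Hodge types of `H²(K3)`.
[cite: WarnerGTM94, Thm. 5.36 / Thm. 5.45] [cite: Huybrechts2019, Cor. 0.4 (ii)] -/
theorem stub_cmSelfSimilitude_algebraic :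
    (∀ (E : Type) [NormedAddCommGroup E] [NormedSpace ℂ E] [FiniteDimensional ℂ E],
      Literature.NumberTheory.Transcendental.exists_deRhamIsoFamily 𝓘(ℝ, E)) →
    Buskin2019_hodgeConjectureFor_square_of_CM → Huybrechts_K3_hodgeTypes_H2 →
    ∀ (c : ℂ), c ≠ 0 → ∀ (J : Module.End ℂ (K3Index → ℂ)), RatEnd[J] →
      (∀ a b, k3Form (J a) (J b) = c * k3Form a b) →
      ∀ (x₀ : K3Index → ℂ) (t : ℂ), t.im ≠ 0 → J x₀ = t • x₀ →
      ∀ (μ : OrientationFamily), μ.HasPoincareDuality →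
        ∀ (S : SchemeOver ℂ) (hS : IsK3Surface S)
          (η : complexBetti S (2 * 1) ≃ₗ[ℂ] (K3Index → ℂ)) (p : complexBetti S (2 * 2)),
          MarkedK3[S, η, p, x₀] → PeriodPt[x₀] →
          ∃ γ ∈ algebraicClasses (MonoidalCategoryStruct.tensorObj S S) 2,
            ∀ y : complexBetti S (2 * 1), η.symm (J (η y)) = Corr[μ, S, S, hS, hS ; γ, y] :=
  fun hdR => cmSelfSimilitude_algebraic_of_cupPreservesHodgeType fun _ hS ⟨B⟩ =>
    cupPreservesHodgeType_of_exists_deRhamIsoFamily hodgePQ_independent_of_hodgeModel_holds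
      hS.isSmoothProjective_tensor_self B (hdR B.model)

end Stub

end Summit.HodgeConjecture.HodgeConjecture.Theorems.NikulinTwinTransport.CmNormAnchors

end
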